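import Summits.AtomisticToContinuum.Crystallization.Theorems.HullExactificationCascadeExactHcpLocalTheoremRigidity

/-!
# Route HullExactificationCascade — item `ExactHcpLocalTheorem` (G), helper 4: hexagon rigidity and the bond window

Helper file 4 for `stmt-AtomisticToContinuum-12093`.  **Hexagon rigidity** (`image_cluster_of_hexagon`):
if the image `A '' N` of the thirteen-point cluster under a linear isometry contains the seven
hexagon-layer sites, then `A '' N` is `N` or its twin `halfTurn '' N` (the cluster of an odd-layer
site); with the extra point `−(w + h e₃)` it is the twin (`image_cluster_eq_twin`, the interlayer
step).  Then the distance tables of the **bond window** (cluster sites `x` with `u + x` again a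
cluster site: `0, −u, −v, v − u, w − u ± h e₃`) used by the in-layer step, all by `hcp_dist_sq_eq` and
the envelope `64/100 a² < h² < 69/100 a²` (which separates `3a²`, `4a²/3 + h²`, `a²/3 + h²`, `4h²`).
[folklore]
-/

noncomputable section

namespace Summit.AtomisticToContinuum.Crystallization.Theorems.ExactHcpLocal

open Literature.MathematicalPhysics.StatisticalMechanics

variable {a h : ℝ}

/-! ## Hexagon file: hexagon rigidity of the cluster and the interlayer core -/

section Hexagon

open RealInnerProductSpace Literature.Geometry.DiscreteGeometry

/-- **Hexagon rigidity of the cluster.** If the image `A '' N` of the thirteen-point cluster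
under a linear isometry `A` fixing `u` contains the seven hexagon-layer sites, then
`A '' N = N` or `A '' N = halfTurn '' N` (the cluster or its twin): `A` permutes the hexagon, so
`A v ∈ {v, u − v}`; if `A v = v` then `A ∈ {1, σ_h}` fixes `N`; if `A v = u − v` then
`A = F ∘ A''` with `A''` fixing `u, v` and `F = halfTurn ∘ M_u` the vertical mirror through `u`,
which maps `N` to its twin. [folklore] -/
theorem image_cluster_of_hexagon_of_fix_u (ha : 0 < a) (hh : 0 < h)
    (hh1 : 64 / 100 * a ^ 2 < h ^ 2) (hh2 : h ^ 2 < 69 / 100 * a ^ 2)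
    (A : EuclideanSpace ℝ (Fin 3) ≃ₗᵢ[ℝ] EuclideanSpace ℝ (Fin 3))
    (hAu : A (barlowPos a h alternatingHagg 0 1 0) = barlowPos a h alternatingHagg 0 1 0)
    (hX : ∀ i j : ℤ, (-1 ≤ i ∧ i ≤ 1 ∧ -1 ≤ j ∧ j ≤ 1 ∧ -1 ≤ i + j ∧ i + j ≤ 1) →
      barlowPos a h alternatingHagg 0 i j ∈
        A '' {p : EuclideanSpace ℝ (Fin 3) | p ∈ hcpStacking a h ∧ ‖p‖ < 13 / 10 * a}) :
    A '' {p : EuclideanSpace ℝ (Fin 3) | p ∈ hcpStacking a h ∧ ‖p‖ < 13 / 10 * a} =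
        {p : EuclideanSpace ℝ (Fin 3) | p ∈ hcpStacking a h ∧ ‖p‖ < 13 / 10 * a} ∨
      A '' {p : EuclideanSpace ℝ (Fin 3) | p ∈ hcpStacking a h ∧ ‖p‖ < 13 / 10 * a} =
        halfTurn '' {p : EuclideanSpace ℝ (Fin 3) | p ∈ hcpStacking a h ∧ ‖p‖ < 13 / 10 * a} := by
  set N := {p : EuclideanSpace ℝ (Fin 3) | p ∈ hcpStacking a h ∧ ‖p‖ < 13 / 10 * a} with hN
  set u := barlowPos a h alternatingHagg 0 1 0 with hudef
  set v := barlowPos a h alternatingHagg 0 0 1 with hvdef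
  -- the hexagon layer of the cluster as a finite set, and `A⁻¹` acting on it
  set X : Set (EuclideanSpace ℝ (Fin 3)) := (fun q : ℤ × ℤ => barlowPos a h alternatingHagg 0 q.1 q.2) ''
    ({(0, 0), (1, 0), (-1, 0), (0, 1), (0, -1), (1, -1), (-1, 1)} : Set (ℤ × ℤ)) with hXdef
  have hXfin : X.Finite := (Set.toFinite _).image _
  have memX : ∀ {x}, x ∈ X ↔ ∃ i j : ℤ, (-1 ≤ i ∧ i ≤ 1 ∧ -1 ≤ j ∧ j ≤ 1 ∧ -1 ≤ i + j ∧ i + j ≤ 1) ∧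
      x = barlowPos a h alternatingHagg 0 i j := by
    intro x
    simp only [hXdef, Set.mem_image, Set.mem_insert_iff, Set.mem_singleton_iff, Prod.exists,
      Prod.mk.injEq]
    constructor
    · rintro ⟨i, j, hij, rfl⟩
      exact ⟨i, j, by omega, rfl⟩
    · rintro ⟨i, j, hij, rfl⟩
      obtain ⟨hi1, hi2, hj1, hj2, hs1, hs2⟩ := hij
      refine ⟨i, j, ?_, rfl⟩
      interval_cases i <;> interval_cases j <;> first | (exfalso; omega) | decide
  haveI : Finite X := hXfin.to_subtype
  have maps : ∀ x : X, A.symm (x : EuclideanSpace ℝ (Fin 3)) ∈ X := by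
    rintro ⟨x, hx⟩
    obtain ⟨i, j, hij, rfl⟩ := memX.1 hx
    obtain ⟨i', j', hij', he⟩ := symm_hexagon ha hh hh1 hh2 A hX hij
    exact memX.2 ⟨i', j', hij', he⟩
  set f : X → X := fun x => ⟨A.symm x, maps x⟩ with hf
  have finj : Function.Injective f := by
    rintro ⟨x, hx⟩ ⟨y, hy⟩ hxy
    have := congrArg (fun z : X => (z : EuclideanSpace ℝ (Fin 3))) hxy
    exact Subtype.ext (A.symm.injective this)
  have fsurj := Finite.surjective_of_injective finj
  -- hence `A v` is a hexagon site
  have hvX : v ∈ X := memX.2 ⟨0, 1, by omega, rfl⟩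
  obtain ⟨⟨x, hx⟩, hxv⟩ := fsurj ⟨v, hvX⟩
  have hAv : A v = x := by
    have : A.symm x = v := congrArg (fun z : X => (z : EuclideanSpace ℝ (Fin 3))) hxv
    rw [← this, A.apply_symm_apply]
  obtain ⟨i, j, hij, rfl⟩ := memX.1 hx
  -- `⟪u, A v⟫ = a²/2` pins `A v ∈ {v, u − v}`
  have hinner : ⟪u, A v⟫ = a ^ 2 / 2 := by
    rw [← hAu, A.inner_map_map, hudef, hvdef, inner_u_site, haggLabel_zero]; push_cast; ring
  rw [hAv, hudef, inner_u_site, haggLabel_zero] at hinner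
  push_cast at hinner
  have h2ij : (2 : ℝ) * i + j = 1 := by
    have ha2 : a ^ 2 ≠ 0 := by positivity
    field_simp at hinner
    linarith
  have h2ij' : 2 * i + j = 1 := by exact_mod_cast h2ij
  have hcases : (i = 0 ∧ j = 1) ∨ (i = 1 ∧ j = -1) := by omega
  -- the symmetries
  have hNdef : ∀ g : EuclideanSpace ℝ (Fin 3) ≃ₗᵢ[ℝ] EuclideanSpace ℝ (Fin 3),
      (∀ x, g x ∈ hcpStacking a h ↔ x ∈ hcpStacking a h) → g '' N = N :=
    fun g hg => image_cluster_eq_of_mem_iff hg _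
  rcases hcases with ⟨rfl, rfl⟩ | ⟨rfl, rfl⟩
  · -- `A v = v`: `A = 1` or `σ_h`
    left
    rcases eq_refl_or_mirrorH ha.ne' hh.ne' A hAu hAv with h1 | h1
    · have : A = LinearIsometryEquiv.refl ℝ _ := LinearIsometryEquiv.ext h1
      rw [this]; simp
    · have : A = (ℝ ∙ layerNormal h)ᗮ.reflection := LinearIsometryEquiv.ext h1
      rw [this]
      exact hNdef _ (mirrorH_mem_iff hh.ne')
  · -- `A v = u - v`: `A = F ∘ A''`, `F = halfTurn ∘ M_u`
    right
    set Mu := (ℝ ∙ barlowPos a h alternatingHagg 0 1 0)ᗮ.reflection with hMu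
    set F := Mu.trans halfTurn with hF
    have hFu : F u = u := by
      rw [hF, LinearIsometryEquiv.trans_apply, hMu, hudef, mirrorU_site ha.ne', haggLabel_zero,
        halfTurn_site]
      norm_num
      rw [site_sub_of_odd odd_one]
      all_goals norm_num
    have hFv : F v = barlowPos a h alternatingHagg 0 1 (-1) := by
      rw [hF, LinearIsometryEquiv.trans_apply, hMu, hvdef, mirrorU_site ha.ne', haggLabel_zero,
        halfTurn_site]
      norm_num
      rw [site_sub_of_odd odd_one]
      all_goals norm_num
    set A'' := A.trans F.symm with hA''
    have hA''u : A'' u = u := by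
      rw [hA'', LinearIsometryEquiv.trans_apply, hAu, ← hFu, F.symm_apply_apply, hFu]
    have hA''v : A'' v = v := by
      rw [hA'', LinearIsometryEquiv.trans_apply, hAv, ← hFv, F.symm_apply_apply]
    have hAN : A '' N = F '' (A'' '' N) := by
      have hfun : (fun x => F (A'' x)) = A := by
        funext x; simp [hA'']
      rw [Set.image_image, hfun]
    have hFN : F '' N = halfTurn '' N := by
      rw [hF]
      have : (Mu.trans halfTurn : EuclideanSpace ℝ (Fin 3) → EuclideanSpace ℝ (Fin 3)) =
          halfTurn ∘ Mu := rfl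
      rw [this, Set.image_comp, hNdef _ (mirrorU_mem_iff ha.ne')]
    rcases eq_refl_or_mirrorH ha.ne' hh.ne' A'' hA''u hA''v with h1 | h1
    · have : A'' = LinearIsometryEquiv.refl ℝ _ := LinearIsometryEquiv.ext h1
      rw [hAN, this, ← hFN]; simp
    · have : A'' = (ℝ ∙ layerNormal h)ᗮ.reflection := LinearIsometryEquiv.ext h1
      rw [hAN, this, hNdef _ (mirrorH_mem_iff hh.ne'), hFN]

/-- **Hexagon rigidity of the cluster** (no normalisation): if `A '' N` contains the seven
hexagon-layer sites then `A '' N` is the cluster `N` or its twin `halfTurn '' N`. Reduce to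
`image_cluster_of_hexagon_of_fix_u` by precomposing with a symmetry of hcp sending `u` to
`A⁻¹ u` (transitivity of the stabiliser on the hexagon). [folklore] -/
theorem image_cluster_of_hexagon (ha : 0 < a) (hh : 0 < h)
    (hh1 : 64 / 100 * a ^ 2 < h ^ 2) (hh2 : h ^ 2 < 69 / 100 * a ^ 2)
    (A : EuclideanSpace ℝ (Fin 3) ≃ₗᵢ[ℝ] EuclideanSpace ℝ (Fin 3))
    (hX : ∀ i j : ℤ, (-1 ≤ i ∧ i ≤ 1 ∧ -1 ≤ j ∧ j ≤ 1 ∧ -1 ≤ i + j ∧ i + j ≤ 1) →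
      barlowPos a h alternatingHagg 0 i j ∈
        A '' {p : EuclideanSpace ℝ (Fin 3) | p ∈ hcpStacking a h ∧ ‖p‖ < 13 / 10 * a}) :
    A '' {p : EuclideanSpace ℝ (Fin 3) | p ∈ hcpStacking a h ∧ ‖p‖ < 13 / 10 * a} =
        {p : EuclideanSpace ℝ (Fin 3) | p ∈ hcpStacking a h ∧ ‖p‖ < 13 / 10 * a} ∨
      A '' {p : EuclideanSpace ℝ (Fin 3) | p ∈ hcpStacking a h ∧ ‖p‖ < 13 / 10 * a} =
        halfTurn '' {p : EuclideanSpace ℝ (Fin 3) | p ∈ hcpStacking a h ∧ ‖p‖ < 13 / 10 * a} := by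
  set N := {p : EuclideanSpace ℝ (Fin 3) | p ∈ hcpStacking a h ∧ ‖p‖ < 13 / 10 * a} with hN
  obtain ⟨i', j', hij', he⟩ := symm_hexagon ha hh hh1 hh2 A hX (i := 1) (j := 0) (by omega)
  have h0 : ¬ (i' = 0 ∧ j' = 0) := by
    rintro ⟨rfl, rfl⟩
    rw [barlowPos_alternating_zero, LinearIsometryEquiv.map_eq_zero_iff] at he
    have := congrArg (fun x : EuclideanSpace ℝ (Fin 3) => x 0) he
    simp [haggLabel_zero] at this
    exact ha.ne' this
  obtain ⟨g, hg, hgu⟩ := exists_sym_apply_u (h := h) ha.ne' hij' h0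
  set A' := g.trans A with hA'
  have hA'N : A' '' N = A '' N := by
    have : (A' : EuclideanSpace ℝ (Fin 3) → EuclideanSpace ℝ (Fin 3)) = A ∘ g := rfl
    rw [this, Set.image_comp, image_cluster_eq_of_mem_iff hg]
  have hA'u : A' (barlowPos a h alternatingHagg 0 1 0) = barlowPos a h alternatingHagg 0 1 0 := by
    rw [hA', LinearIsometryEquiv.trans_apply, hgu, ← he, A.apply_symm_apply]
  have hX' : ∀ i j : ℤ, (-1 ≤ i ∧ i ≤ 1 ∧ -1 ≤ j ∧ j ≤ 1 ∧ -1 ≤ i + j ∧ i + j ≤ 1) →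
      barlowPos a h alternatingHagg 0 i j ∈ A' '' N := by
    intro i j hij; rw [hA'N]; exact hX i j hij
  rw [← hA'N]
  exact image_cluster_of_hexagon_of_fix_u ha hh hh1 hh2 A' hA'u hX'

/-- **Interlayer rigidity.** If `A '' N` contains the hexagon layer of the cluster and the point
`−(w + h e₃)`, then `A '' N = halfTurn '' N` (the twin cluster): `−(w + h e₃)` is not a site, so
`A '' N ≠ N`. [folklore] -/
theorem image_cluster_eq_twin (ha : 0 < a) (hh : 0 < h)
    (hh1 : 64 / 100 * a ^ 2 < h ^ 2) (hh2 : h ^ 2 < 69 / 100 * a ^ 2)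
    (A : EuclideanSpace ℝ (Fin 3) ≃ₗᵢ[ℝ] EuclideanSpace ℝ (Fin 3))
    (hX : ∀ i j : ℤ, (-1 ≤ i ∧ i ≤ 1 ∧ -1 ≤ j ∧ j ≤ 1 ∧ -1 ≤ i + j ∧ i + j ≤ 1) →
      barlowPos a h alternatingHagg 0 i j ∈
        A '' {p : EuclideanSpace ℝ (Fin 3) | p ∈ hcpStacking a h ∧ ‖p‖ < 13 / 10 * a})
    (hp : -barlowPos a h alternatingHagg 1 0 0 ∈
        A '' {p : EuclideanSpace ℝ (Fin 3) | p ∈ hcpStacking a h ∧ ‖p‖ < 13 / 10 * a}) :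
    A '' {p : EuclideanSpace ℝ (Fin 3) | p ∈ hcpStacking a h ∧ ‖p‖ < 13 / 10 * a} =
      halfTurn '' {p : EuclideanSpace ℝ (Fin 3) | p ∈ hcpStacking a h ∧ ‖p‖ < 13 / 10 * a} := by
  rcases image_cluster_of_hexagon ha hh hh1 hh2 A hX with h1 | h1
  · exfalso
    rw [h1] at hp
    exact Int.not_even_one (even_of_neg_site_mem ha.ne' hh.ne' hp.1)
  · exact h1

end Hexagon


/-! ## In-layer file: bond rigidity along the in-layer bond `u` -/

section InLayer

open RealInnerProductSpace Literature.Geometry.DiscreteGeometry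

/-- Squared distances of sites with concrete letters: the polynomial of `hcp_dist_sq_eq` with the
letters of layers `0, ±1` evaluated. [folklore] -/
theorem dist_sq_sites (k i j k' i' j' : ℤ) (L L' : ℤ)
    (hL : haggLabel alternatingHagg k = L) (hL' : haggLabel alternatingHagg k' = L') :
    dist (barlowPos a h alternatingHagg k i j) (barlowPos a h alternatingHagg k' i' j') ^ 2 =
      a ^ 2 * (((i : ℝ) - i') ^ 2 + ((i : ℝ) - i') * ((j : ℝ) - j') + ((j : ℝ) - j') ^ 2 +
        ((L : ℝ) - L') * (((i : ℝ) - i') + ((j : ℝ) - j')) + ((L : ℝ) - L') ^ 2 / 3) +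
      ((k : ℝ) - k') ^ 2 * h ^ 2 := by
  rw [hcp_dist_sq_eq, hL, hL']

/-- The window indices (cluster sites `x` with `u + x` again a cluster site) have
`k ∈ {−1, 0, 1}`, `i ∈ {−1, 0}`, `j ∈ {−1, 0, 1}`. [folklore] -/
theorem window_bounds {k i j : ℤ}
    (hK : (k = 0 ∧ -1 ≤ i ∧ i ≤ 0 ∧ -1 ≤ j ∧ j ≤ 1 ∧ -1 ≤ i + j ∧ i + j ≤ 0) ∨
      ((k = 1 ∨ k = -1) ∧ i = -1 ∧ j = 0)) :
    -1 ≤ k ∧ k ≤ 1 ∧ -1 ≤ i ∧ i ≤ 0 ∧ -1 ≤ j ∧ j ≤ 1 := by omega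

/-- **Distance table I.** No window site is at squared distance `4a²/3 + h²` from `v − u`.
[folklore] -/
theorem window_dist_ne_one (ha : 0 < a) (hh1 : 64 / 100 * a ^ 2 < h ^ 2)
    (hh2 : h ^ 2 < 69 / 100 * a ^ 2) {k i j : ℤ}
    (hK : (k = 0 ∧ -1 ≤ i ∧ i ≤ 0 ∧ -1 ≤ j ∧ j ≤ 1 ∧ -1 ≤ i + j ∧ i + j ≤ 0) ∨
      ((k = 1 ∨ k = -1) ∧ i = -1 ∧ j = 0)) :
    dist (barlowPos a h alternatingHagg k i j) (barlowPos a h alternatingHagg 0 (-1) 1) ^ 2 ≠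
      4 * a ^ 2 / 3 + h ^ 2 := by
  have hL0 : haggLabel alternatingHagg 0 = 0 := haggLabel_zero _
  have hL1 : haggLabel alternatingHagg 1 = 1 := haggLabel_alternating_of_odd odd_one
  have hLm : haggLabel alternatingHagg (-1) = 1 := haggLabel_alternating_of_odd (by decide)
  have ha2 : 0 < a ^ 2 := by positivity
  obtain ⟨hk1, hk2, hi1, hi2, hj1, hj2⟩ := window_bounds hK
  interval_cases k <;> interval_cases i <;> interval_cases j <;>
    first
    | (exfalso; omega)
    | (rw [dist_sq_sites (a := a) (h := h) _ _ _ _ _ _ _ _ hLm hL0]; push_cast; nlinarith)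
    | (rw [dist_sq_sites (a := a) (h := h) _ _ _ _ _ _ _ _ hL0 hL0]; push_cast; nlinarith)
    | (rw [dist_sq_sites (a := a) (h := h) _ _ _ _ _ _ _ _ hL1 hL0]; push_cast; nlinarith)

/-- **Distance table II.** No window site is at squared distance `3a²` from the cap site
`w − u + h e₃ = 𝔰 1 (−1) 0`. [folklore] -/
theorem window_dist_ne_two (ha : 0 < a) (hh1 : 64 / 100 * a ^ 2 < h ^ 2)
    (hh2 : h ^ 2 < 69 / 100 * a ^ 2) {k i j : ℤ}
    (hK : (k = 0 ∧ -1 ≤ i ∧ i ≤ 0 ∧ -1 ≤ j ∧ j ≤ 1 ∧ -1 ≤ i + j ∧ i + j ≤ 0) ∨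
      ((k = 1 ∨ k = -1) ∧ i = -1 ∧ j = 0)) :
    dist (barlowPos a h alternatingHagg k i j) (barlowPos a h alternatingHagg 1 (-1) 0) ^ 2 ≠
      3 * a ^ 2 := by
  have hL0 : haggLabel alternatingHagg 0 = 0 := haggLabel_zero _
  have hL1 : haggLabel alternatingHagg 1 = 1 := haggLabel_alternating_of_odd odd_one
  have hLm : haggLabel alternatingHagg (-1) = 1 := haggLabel_alternating_of_odd (by decide)
  have ha2 : 0 < a ^ 2 := by positivity
  obtain ⟨hk1, hk2, hi1, hi2, hj1, hj2⟩ := window_bounds hK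
  interval_cases k <;> interval_cases i <;> interval_cases j <;>
    first
    | (exfalso; omega)
    | (rw [dist_sq_sites (a := a) (h := h) _ _ _ _ _ _ _ _ hLm hL1]; push_cast; nlinarith)
    | (rw [dist_sq_sites (a := a) (h := h) _ _ _ _ _ _ _ _ hL0 hL1]; push_cast; nlinarith)
    | (rw [dist_sq_sites (a := a) (h := h) _ _ _ _ _ _ _ _ hL1 hL1]; push_cast; nlinarith)

/-- **Distance table III.** No window site is at squared distance `3a²` from the cap site
`w − u − h e₃ = 𝔰 (−1) (−1) 0`. [folklore] -/
theorem window_dist_ne_three (ha : 0 < a) (hh1 : 64 / 100 * a ^ 2 < h ^ 2)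
    (hh2 : h ^ 2 < 69 / 100 * a ^ 2) {k i j : ℤ}
    (hK : (k = 0 ∧ -1 ≤ i ∧ i ≤ 0 ∧ -1 ≤ j ∧ j ≤ 1 ∧ -1 ≤ i + j ∧ i + j ≤ 0) ∨
      ((k = 1 ∨ k = -1) ∧ i = -1 ∧ j = 0)) :
    dist (barlowPos a h alternatingHagg k i j) (barlowPos a h alternatingHagg (-1) (-1) 0) ^ 2 ≠
      3 * a ^ 2 := by
  have hL0 : haggLabel alternatingHagg 0 = 0 := haggLabel_zero _
  have hL1 : haggLabel alternatingHagg 1 = 1 := haggLabel_alternating_of_odd odd_one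
  have hLm : haggLabel alternatingHagg (-1) = 1 := haggLabel_alternating_of_odd (by decide)
  have ha2 : 0 < a ^ 2 := by positivity
  obtain ⟨hk1, hk2, hi1, hi2, hj1, hj2⟩ := window_bounds hK
  interval_cases k <;> interval_cases i <;> interval_cases j <;>
    first
    | (exfalso; omega)
    | (rw [dist_sq_sites (a := a) (h := h) _ _ _ _ _ _ _ _ hLm hLm]; push_cast; nlinarith)
    | (rw [dist_sq_sites (a := a) (h := h) _ _ _ _ _ _ _ _ hL0 hLm]; push_cast; nlinarith)
    | (rw [dist_sq_sites (a := a) (h := h) _ _ _ _ _ _ _ _ hL1 hLm]; push_cast; nlinarith)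

/-- The window sites other than `0` and `−u` are `−v, v − u, w − u ± h e₃`. [folklore] -/
theorem window_four {k i j : ℤ}
    (hK : (k = 0 ∧ -1 ≤ i ∧ i ≤ 0 ∧ -1 ≤ j ∧ j ≤ 1 ∧ -1 ≤ i + j ∧ i + j ≤ 0) ∨
      ((k = 1 ∨ k = -1) ∧ i = -1 ∧ j = 0))
    (h0 : ¬ (k = 0 ∧ i = 0 ∧ j = 0)) (hu : ¬ (k = 0 ∧ i = -1 ∧ j = 0)) :
    (k = 0 ∧ i = 0 ∧ j = -1) ∨ (k = 0 ∧ i = -1 ∧ j = 1) ∨ (k = 1 ∧ i = -1 ∧ j = 0) ∨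
      (k = -1 ∧ i = -1 ∧ j = 0) := by
  obtain ⟨hk1, hk2, hi1, hi2, hj1, hj2⟩ := window_bounds hK
  interval_cases k <;> interval_cases i <;> interval_cases j <;>
    first
    | (exfalso; omega)
    | decide

/-- **Distance table IV.** Two window sites other than `0` and `−u` at squared distance `a²`:
one of them is `v − u = 𝔰 0 (−1) 1` (the only pairs at distance `a` among
`{−v, v − u, w − u ± h e₃}` are `{v − u, w − u ± h e₃}`, and only at the ideal ratio). [folklore] -/
theorem window_pair_dist_eq (ha : 0 < a) (hh1 : 64 / 100 * a ^ 2 < h ^ 2)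
    (hh2 : h ^ 2 < 69 / 100 * a ^ 2) {k i j k' i' j' : ℤ}
    (hK : (k = 0 ∧ -1 ≤ i ∧ i ≤ 0 ∧ -1 ≤ j ∧ j ≤ 1 ∧ -1 ≤ i + j ∧ i + j ≤ 0) ∨
      ((k = 1 ∨ k = -1) ∧ i = -1 ∧ j = 0))
    (h0 : ¬ (k = 0 ∧ i = 0 ∧ j = 0)) (hu : ¬ (k = 0 ∧ i = -1 ∧ j = 0))
    (hK' : (k' = 0 ∧ -1 ≤ i' ∧ i' ≤ 0 ∧ -1 ≤ j' ∧ j' ≤ 1 ∧ -1 ≤ i' + j' ∧ i' + j' ≤ 0) ∨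
      ((k' = 1 ∨ k' = -1) ∧ i' = -1 ∧ j' = 0))
    (h0' : ¬ (k' = 0 ∧ i' = 0 ∧ j' = 0)) (hu' : ¬ (k' = 0 ∧ i' = -1 ∧ j' = 0))
    (hd : dist (barlowPos a h alternatingHagg k i j) (barlowPos a h alternatingHagg k' i' j') ^ 2 =
      a ^ 2) :
    (k = 0 ∧ i = -1 ∧ j = 1) ∨ (k' = 0 ∧ i' = -1 ∧ j' = 1) := by
  have hL0 : haggLabel alternatingHagg 0 = 0 := haggLabel_zero _
  have hL1 : haggLabel alternatingHagg 1 = 1 := haggLabel_alternating_of_odd odd_one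
  have hLm : haggLabel alternatingHagg (-1) = 1 := haggLabel_alternating_of_odd (by decide)
  have ha2 : 0 < a ^ 2 := by positivity
  -- the four sites `−v, v − u, w − u + e, w − u − e`
  have hfour := window_four hK h0 hu
  have hfour' := window_four hK' h0' hu'
  rcases hfour with ⟨rfl, rfl, rfl⟩ | ⟨rfl, rfl, rfl⟩ | ⟨rfl, rfl, rfl⟩ | ⟨rfl, rfl, rfl⟩
  · rcases hfour' with ⟨rfl, rfl, rfl⟩ | ⟨rfl, rfl, rfl⟩ | ⟨rfl, rfl, rfl⟩ | ⟨rfl, rfl, rfl⟩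
    · rw [dist_sq_sites (a := a) (h := h) _ _ _ _ _ _ _ _ hL0 hL0] at hd; push_cast at hd; nlinarith
    · right; exact ⟨rfl, rfl, rfl⟩
    · rw [dist_sq_sites (a := a) (h := h) _ _ _ _ _ _ _ _ hL0 hL1] at hd; push_cast at hd; nlinarith
    · rw [dist_sq_sites (a := a) (h := h) _ _ _ _ _ _ _ _ hL0 hLm] at hd; push_cast at hd; nlinarith
  · left; exact ⟨rfl, rfl, rfl⟩
  · rcases hfour' with ⟨rfl, rfl, rfl⟩ | ⟨rfl, rfl, rfl⟩ | ⟨rfl, rfl, rfl⟩ | ⟨rfl, rfl, rfl⟩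
    · rw [dist_sq_sites (a := a) (h := h) _ _ _ _ _ _ _ _ hL1 hL0] at hd; push_cast at hd; nlinarith
    · right; exact ⟨rfl, rfl, rfl⟩
    · rw [dist_sq_sites (a := a) (h := h) _ _ _ _ _ _ _ _ hL1 hL1] at hd; push_cast at hd; nlinarith
    · rw [dist_sq_sites (a := a) (h := h) _ _ _ _ _ _ _ _ hL1 hLm] at hd; push_cast at hd; nlinarith
  · rcases hfour' with ⟨rfl, rfl, rfl⟩ | ⟨rfl, rfl, rfl⟩ | ⟨rfl, rfl, rfl⟩ | ⟨rfl, rfl, rfl⟩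
    · rw [dist_sq_sites (a := a) (h := h) _ _ _ _ _ _ _ _ hLm hL0] at hd; push_cast at hd; nlinarith
    · right; exact ⟨rfl, rfl, rfl⟩
    · rw [dist_sq_sites (a := a) (h := h) _ _ _ _ _ _ _ _ hLm hL1] at hd; push_cast at hd; nlinarith
    · rw [dist_sq_sites (a := a) (h := h) _ _ _ _ _ _ _ _ hLm hLm] at hd; push_cast at hd; nlinarith

/-- **The bond window.** Let `A` be a linear isometry whose image cluster `A '' N` agrees with the
translate `N − u` on the ball `‖x‖ < 13/10 a` (the exactness information carried along the bond
`u`), and let `q := A⁻¹(−u)`.  Then every cluster site within `13/10 a` of `q` is mapped by `A`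
to a **window site**: a cluster site `x` with `u + x` again a cluster site. [folklore] -/
theorem window_of_bond (ha : 0 < a) (hh1 : 64 / 100 * a ^ 2 < h ^ 2) (hh2 : h ^ 2 < 69 / 100 * a ^ 2)
    (A : EuclideanSpace ℝ (Fin 3) ≃ₗᵢ[ℝ] EuclideanSpace ℝ (Fin 3))
    (hK : ∀ x : EuclideanSpace ℝ (Fin 3),
      (x ∈ A '' {p : EuclideanSpace ℝ (Fin 3) | p ∈ hcpStacking a h ∧ ‖p‖ < 13 / 10 * a} ∧
          ‖barlowPos a h alternatingHagg 0 1 0 + x‖ < 13 / 10 * a) ↔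
        (barlowPos a h alternatingHagg 0 1 0 + x ∈
            {p : EuclideanSpace ℝ (Fin 3) | p ∈ hcpStacking a h ∧ ‖p‖ < 13 / 10 * a} ∧
          ‖x‖ < 13 / 10 * a))
    {x : EuclideanSpace ℝ (Fin 3)}
    (hx : x ∈ {p : EuclideanSpace ℝ (Fin 3) | p ∈ hcpStacking a h ∧ ‖p‖ < 13 / 10 * a})
    (hxq : ‖x - A.symm (-barlowPos a h alternatingHagg 0 1 0)‖ < 13 / 10 * a) :
    ∃ k i j : ℤ, ((k = 0 ∧ -1 ≤ i ∧ i ≤ 0 ∧ -1 ≤ j ∧ j ≤ 1 ∧ -1 ≤ i + j ∧ i + j ≤ 0) ∨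
      ((k = 1 ∨ k = -1) ∧ i = -1 ∧ j = 0)) ∧ A x = barlowPos a h alternatingHagg k i j := by
  set u := barlowPos a h alternatingHagg 0 1 0 with hudef
  have h1 : A x ∈ A '' {p : EuclideanSpace ℝ (Fin 3) | p ∈ hcpStacking a h ∧ ‖p‖ < 13 / 10 * a} :=
    Set.mem_image_of_mem _ hx
  have h2 : ‖u + A x‖ < 13 / 10 * a := by
    have : u + A x = A (x - A.symm (-u)) := by
      rw [map_sub, A.apply_symm_apply]; abel
    rw [this, LinearIsometryEquiv.norm_map]; exact hxq
  obtain ⟨⟨⟨k', i', j', hk'⟩, hn1⟩, hn2⟩ := (hK (A x)).1 ⟨h1, h2⟩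
  have hAx : A x = barlowPos a h alternatingHagg k' (i' - 1) j' := by
    have : A x = barlowPos a h alternatingHagg k' i' j' - u := by rw [← hk']; abel
    rw [this, hudef, site_sub_of_even Even.zero]
    simp
  rw [hk'] at hn1
  rw [hAx] at hn2
  have i1 := (norm_site_lt_iff ha hh1 hh2 _ _ _).1 hn1
  have i2 := (norm_site_lt_iff ha hh1 hh2 _ _ _).1 hn2
  exact ⟨k', i' - 1, j', by omega, hAx⟩

/-- A cluster site: membership in `N` from the index description. [folklore] -/
theorem site_mem_cluster (ha : 0 < a) (hh1 : 64 / 100 * a ^ 2 < h ^ 2) (hh2 : h ^ 2 < 69 / 100 * a ^ 2)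
    {k i j : ℤ}
    (hL : (k = 0 ∧ -1 ≤ i ∧ i ≤ 1 ∧ -1 ≤ j ∧ j ≤ 1 ∧ -1 ≤ i + j ∧ i + j ≤ 1) ∨
      ((k = 1 ∨ k = -1) ∧ -1 ≤ i ∧ i ≤ 0 ∧ -1 ≤ j ∧ j ≤ 0 ∧ -1 ≤ i + j)) :
    barlowPos a h alternatingHagg k i j ∈
      {p : EuclideanSpace ℝ (Fin 3) | p ∈ hcpStacking a h ∧ ‖p‖ < 13 / 10 * a} :=
  ⟨barlowPos_mem _ _ _, (norm_site_lt_iff ha hh1 hh2 k i j).2 hL⟩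

end InLayer

end Summit.AtomisticToContinuum.Crystallization.Theorems.ExactHcpLocal

end
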